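import Literature.MathematicalPhysics.QuantumLattice.HubbardPolymerBounds
import Literature.MathematicalPhysics.QuantumLattice.HubbardModel
import Literature.Probability.LatticeModels.PolymerPressureAnalytic
import Mathlib.Algebra.Order.Group.Synonym
import HarnessLib

/-!
# The Hubbard polymer activity on `ℤ^d`: translation invariance, box independence, smallness

Ueltschi (1999), proof of Theorem 2.1 (i) and §3, the infinite-lattice bookkeeping: the polymer
weights `ρ(𝒜)` of the finite subsets `𝒜 ⊂ ℤ^d` are "periodic with respect to lattice
translations", do not depend on the finite volume `Λ ⊇ 𝒜` in which `Tr e^{-βH_Λ}` is expanded,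
and satisfy the smallness required by the cluster expansion (Prop. 2.2) when `βt` is small —
uniformly in `U`. Here:

* `latticeActivity d β U μ τ A` — the site activity (`HubbardPolymerRepresentation.siteActivity`)
  of `A : Finset (Site d)` computed INTRINSICALLY, on the Fock space of the sites of `A` with the
  lexicographic order and the induced nearest-neighbour graph (`PolySite`, `polyGraph`);
* `siteActivity_eq_latticeActivity` — the universal comparison: for any finite linearly ordered
  volume `Λ` order-embedded in `ℤ^d` (lexicographic order) as an induced subgraph of the
  nearest-neighbour graph, the site activity of `A' ⊆ Λ` computed in `Λ` is the lattice
  activity of its image (covariance `siteActivity_map`); whence TRANSLATION INVARIANCE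
  (`latticeActivity_shiftSet`) and the identification with the weights produced in the boxes
  `{-L,…,L}^d` (`siteActivity_fermionBox`, and the POLYMER REPRESENTATION of the box partition
  function in lattice coordinates, `partitionFn_box_eq`);
* `isSmallTIActivity_latticeActivity` — for `d = 2`, `z₀ ≠ 0`, site ratio `r ≤ 2` and
  `|τ| ≤ τ₀ = (4 e⁶ · 2178)⁻¹`, the lattice activity is an `IsSmallTIActivity` with `δ = 1`
  (`PolymerPressure`), by the finite-volume smallness `sum_norm_siteActivity_mul_exp_le` in a
  large box (`Δ = 4` on `ℤ²`);
* the parameter dependence (reality at real parameters, holomorphy in `(β, μ)`, the admissible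
  complex domain) is in the sibling `HubbardLatticeAnalytic.lean`.

Everything is PROVED.

## Mathlib / tree search

Tree: `siteActivity`, `siteActivity_map`, `isRConnected_of_siteActivity_ne_zero`,
`partitionFn_eq_mul_polymerPartitionFunction` (`HubbardPolymerRepresentation`);
`sum_norm_siteActivity_mul_exp_le`, `siteRatio` (`HubbardPolymerBounds`); `FermionBox`,
`fermionBoxGraph` (`HubbardModel`); `IsSmallTIActivity`, `shiftSet`, `box`, `zdGraph_adj_shift_iff`,
`isRConnected_map_iff`, `polymerPartitionFunction_image`. Mathlib: `Pi.Lex`, `OrderIso.addRight`,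
`OrderEmbedding.ofStrictMono`, `NormedSpace.map_exp`.

## References

* D. Ueltschi, J. Stat. Phys. 95 (1999) 693, §2.3 (periodic weights; Prop. 2.2 hypotheses), §3
  (`|ρ(𝒜)| ≤ e^{-c|𝒜|}` for `2χ e^{c+1} βt ≤ 1`). [Ueltschi1999]
-/

noncomputable section

namespace Literature.MathematicalPhysics.QuantumLattice

open Matrix Finset HubbardWave0 Literature.Probability.LatticeModels
open scoped BigOperators ComplexConjugate

/-! ### Degrees of induced subgraphs of `ℤ^d` -/

section Degree

variable {d : ℕ} {Λ : Type*} [Fintype Λ]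

/-- A finite graph mapped injectively into the nearest-neighbour graph of `ℤ^d` has maximal
degree at most `2d`. [cite: FriedliVelenik2017, §3.1] -/
theorem card_filter_adj_le_of_injective (f : Λ → Site d) (hf : Function.Injective f)
    (G : SimpleGraph Λ) [DecidableRel G.Adj] (hG : ∀ x y, G.Adj x y → (zdGraph d).Adj (f x) (f y)) (v : Λ) :
    (Finset.univ.filter (G.Adj v)).card ≤ 2 * d := by
  classical
  have hsub : (Finset.univ.filter (G.Adj v)).image f ⊆
      (Finset.univ : Finset (Fin d × Bool)).image fun p => if p.2 then f v + Pi.single p.1 1 else f v - Pi.single p.1 1 := by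
    intro z hz
    obtain ⟨y, hy, rfl⟩ := Finset.mem_image.1 hz
    have hadj := hG v y (Finset.mem_filter.1 hy).2
    obtain ⟨i, h | h⟩ := (zdGraph_adj_iff _ _).1 hadj
    · exact Finset.mem_image.2 ⟨(i, true), Finset.mem_univ _, by simp [h]⟩
    · exact Finset.mem_image.2 ⟨(i, false), Finset.mem_univ _, by simp [h]⟩
  calc (Finset.univ.filter (G.Adj v)).card = ((Finset.univ.filter (G.Adj v)).image f).card :=
        (Finset.card_image_of_injective _ hf).symm
    _ ≤ ((Finset.univ : Finset (Fin d × Bool)).image fun p =>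
          if p.2 then f v + Pi.single p.1 1 else f v - Pi.single p.1 1).card := Finset.card_le_card hsub
    _ ≤ (Finset.univ : Finset (Fin d × Bool)).card := Finset.card_image_le
    _ = 2 * d := by rw [Finset.card_univ, Fintype.card_prod, Fintype.card_fin, Fintype.card_bool, mul_comm]

end Degree

/-! ### The sites of a finite subset of `ℤ^d` as a finite ordered volume -/

section PolySite

variable {d : ℕ}

/-- The lexicographically ordered copy of `A ⊆ ℤ^d`. [folklore] -/
def lexSites (A : Finset (Site d)) : Finset (Lex (Site d)) := A.map toLex.toEmbedding

/-- Membership in `lexSites`. [folklore] -/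
@[simp] theorem mem_lexSites {A : Finset (Site d)} {y : Lex (Site d)} : y ∈ lexSites A ↔ ofLex y ∈ A := by
  unfold lexSites
  rw [Finset.mem_map]
  constructor
  · rintro ⟨x, hx, rfl⟩; exact hx
  · intro h; exact ⟨ofLex y, h, rfl⟩

/-- **The sites of the polymer `A`** as a finite linearly ordered type (lexicographic order of
`ℤ^d`): the volume on whose Fock space the weight of `A` is computed. [cite: Ueltschi1999, §2.3 (ρ(𝒜) is a trace over the sites of 𝒜)] -/
abbrev PolySite (A : Finset (Site d)) : Type := ↥(lexSites A)

/-- The induced nearest-neighbour graph on the sites of `A`. [cite: Ueltschi1999, §3] -/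
def polyGraph (A : Finset (Site d)) : SimpleGraph (PolySite A) := (zdGraph d).comap fun x => ofLex x.1

/-- Adjacency in `polyGraph`. [folklore] -/
theorem polyGraph_adj {A : Finset (Site d)} (x y : PolySite A) :
    (polyGraph A).Adj x y ↔ (zdGraph d).Adj (ofLex x.1) (ofLex y.1) := Iff.rfl

/-- Adjacency in `polyGraph` is decidable. [folklore] -/
instance instDecidableRelPolyGraphAdj (A : Finset (Site d)) : DecidableRel (polyGraph A).Adj :=
  inferInstanceAs (DecidableRel ((zdGraph d).comap fun x : PolySite A => ofLex x.1).Adj)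

/-- The site map of `PolySite A`. [folklore] -/
def polySiteEmb (A : Finset (Site d)) : PolySite A ↪ Site d :=
  ⟨fun y => ofLex y.1, fun y y' h => Subtype.ext (by simpa using congrArg toLex h)⟩

/-- The image of all of `PolySite A` is `A`. [folklore] -/
theorem map_univ_polySiteEmb (A : Finset (Site d)) : (Finset.univ : Finset (PolySite A)).map (polySiteEmb A) = A := by
  ext z
  simp only [Finset.mem_map, Finset.mem_univ, true_and, polySiteEmb, Function.Embedding.coeFn_mk]
  constructor
  · rintro ⟨y, rfl⟩; exact mem_lexSites.1 y.2
  · intro hz; exact ⟨⟨toLex z, mem_lexSites.2 hz⟩, rfl⟩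

/-- **The Hubbard polymer activity on `ℤ^d`**: the site activity of `A` computed on its own
sites, `ρ(A) = siteActivity (polyGraph A) β U μ τ univ`. [cite: Ueltschi1999, §2.3 (weights ρ(𝒜)) and §3] -/
def latticeActivity (d : ℕ) (β U μ τ : ℂ) (A : Finset (Site d)) : ℂ :=
  siteActivity (polyGraph A) β U μ τ (Finset.univ : Finset (PolySite A))

end PolySite

/-! ### The universal comparison with finite volumes embedded in `ℤ^d` -/

section Universal

variable {d : ℕ} {Λ : Type*} [LinearOrder Λ]

/-- The site map of an order embedding into lexicographic `ℤ^d`. [folklore] -/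
def siteEmb (f : Λ ↪o Lex (Site d)) : Λ ↪ Site d :=
  ⟨fun x => ofLex (f x), fun x y h => f.injective (by simpa using congrArg toLex h)⟩

/-- `siteEmb` unfolded. [folklore] -/
@[simp] theorem siteEmb_apply (f : Λ ↪o Lex (Site d)) (x : Λ) : siteEmb f x = ofLex (f x) := rfl

variable [Fintype Λ] {G : SimpleGraph Λ} [DecidableRel G.Adj] {β U μ : ℂ}

/-- **Universal comparison.** Let `Λ` be a finite linearly ordered volume, `f : Λ ↪o ℤ^d`
(lexicographic order) embedding the graph `G` as an induced subgraph of the nearest-neighbour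
graph. Then the site activity of `A' ⊆ Λ` computed in `Λ` equals the lattice activity of its
image (`z₀ ≠ 0`). [cite: Ueltschi1999, §2.3 (ρ(𝒜) only involves the sites of 𝒜; periodic weights)] -/
theorem siteActivity_eq_latticeActivity (hz : atomicPartitionFn β U μ ≠ 0) (f : Λ ↪o Lex (Site d))
    (hG : ∀ x y, G.Adj x y ↔ (zdGraph d).Adj (ofLex (f x)) (ofLex (f y))) (τ : ℂ) (A' : Finset Λ) :
    siteActivity G β U μ τ A' = latticeActivity d β U μ τ (A'.map (siteEmb f)) := by
  set A := A'.map (siteEmb f) with hA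
  -- every site of `A` has a unique preimage in `A'`
  have hpre : ∀ y : PolySite A, ∃ x ∈ A', f x = y.1 := by
    intro y
    have hy : ofLex y.1 ∈ A'.map (siteEmb f) := mem_lexSites.1 y.2
    rw [Finset.mem_map] at hy
    obtain ⟨x, hx, hxy⟩ := hy
    refine ⟨x, hx, ?_⟩
    rw [siteEmb_apply] at hxy
    simpa using congrArg toLex hxy
  choose g hgA hgf using hpre
  have hg : StrictMono g := fun y y' h => by
    rw [← f.lt_iff_lt, hgf, hgf]
    exact h
  set ge : PolySite A ↪o Λ := OrderEmbedding.ofStrictMono g hg with hge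
  have hge' : ∀ y, ge y = g y := fun y => rfl
  have hG' : ∀ y y', G.Adj (ge y) (ge y') ↔ (polyGraph A).Adj y y' := fun y y' => by
    rw [hge', hge', hG, hgf, hgf, polyGraph_adj]
  have hmap : (Finset.univ : Finset (PolySite A)).map ge.toEmbedding = A' := by
    ext x
    simp only [Finset.mem_map, Finset.mem_univ, true_and, RelEmbedding.coe_toEmbedding]
    constructor
    · rintro ⟨y, rfl⟩; rw [hge']; exact hgA y
    · intro hx
      have hfx : f x ∈ lexSites A := mem_lexSites.2 (Finset.mem_map.2 ⟨x, hx, rfl⟩)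
      refine ⟨⟨f x, hfx⟩, f.injective ?_⟩
      rw [hge', hgf]
  rw [latticeActivity, ← hmap]
  exact siteActivity_map ge hz hG' τ Finset.univ

/-! ### Translation invariance -/

/-- **Translation invariance of the lattice activity**: `ρ(A + v) = ρ(A)` (`z₀ ≠ 0`).
[cite: Ueltschi1999, §2.3 ("if the weight is periodic with respect to lattice translations")] -/
theorem latticeActivity_shiftSet (hz : atomicPartitionFn β U μ ≠ 0) (τ : ℂ) (v : Site d) (A : Finset (Site d)) :
    latticeActivity d β U μ τ (shiftSet v A) = latticeActivity d β U μ τ A := by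
  -- the shifted inclusion of the sites of `A`
  set f : PolySite A ↪o Lex (Site d) :=
    (OrderEmbedding.subtype fun y => y ∈ lexSites A).trans (OrderIso.addRight (toLex v)).toOrderEmbedding with hf
  have hf' : ∀ y : PolySite A, ofLex (f y) = ofLex y.1 + v := fun y => rfl
  have hG : ∀ x y : PolySite A, (polyGraph A).Adj x y ↔ (zdGraph d).Adj (ofLex (f x)) (ofLex (f y)) := by
    intro x y
    rw [polyGraph_adj, hf', hf', ← Site.shift_apply v (ofLex x.1), ← Site.shift_apply v (ofLex y.1), zdGraph_adj_shift_iff]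
  have h := siteActivity_eq_latticeActivity hz f hG τ Finset.univ
  have hmap : (Finset.univ : Finset (PolySite A)).map (siteEmb f) = shiftSet v A := by
    ext z
    simp only [Finset.mem_map, Finset.mem_univ, true_and, siteEmb_apply, hf', mem_shiftSet]
    constructor
    · rintro ⟨y, rfl⟩
      rw [add_sub_cancel_right]
      exact mem_lexSites.1 y.2
    · intro hz'
      exact ⟨⟨toLex (z - v), mem_lexSites.2 hz'⟩, by simp⟩
  rw [← hmap, ← h]
  rfl

/-! ### The support of the lattice activity -/

/-- **The lattice activity lives on connected sets** (nearest-neighbour graph of `ℤ^d`).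
[cite: Ueltschi1999, §3 ("our polymers are now connected sets")] -/
theorem isRConnected_of_latticeActivity_ne_zero {τ : ℂ} {A : Finset (Site d)}
    (h : latticeActivity d β U μ τ A ≠ 0) : IsRConnected (zdGraph d).Adj A := by
  have h1 : IsRConnected (polyGraph A).Adj (Finset.univ : Finset (PolySite A)) :=
    isRConnected_of_siteActivity_ne_zero h
  rw [← map_univ_polySiteEmb A]
  exact (isRConnected_map_iff (R := (polyGraph A).Adj) (R' := (zdGraph d).Adj) (polySiteEmb A)
    (fun a b => (polyGraph_adj a b).symm) Finset.univ).2 h1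

/-- The induced graph on the sites of `A` has maximal degree `≤ 2d`. [cite: FriedliVelenik2017, §3.1] -/
theorem card_filter_polyGraph_adj_le (A : Finset (Site d)) (y : PolySite A) :
    (Finset.univ.filter ((polyGraph A).Adj y)).card ≤ 2 * d :=
  card_filter_adj_le_of_injective (polySiteEmb A) (polySiteEmb A).injective (polyGraph A)
    (fun a b h => (polyGraph_adj a b).1 h) y

end Universal

/-! ### The boxes `{-L,…,L}^d` -/

section Box

variable {d L : ℕ}

/-- The comparison map `FermionBox d L → ℤ^d` is strictly monotone for the lexicographic
orders. [folklore] -/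
theorem toSite_strictMono : StrictMono fun x : FermionBox d L => toLex (FermionBox.toSite x) := by
  intro a b hab
  have h : ∃ i, (∀ j, j < i → (ofLex a) j = (ofLex b) j) ∧ (ofLex a) i < (ofLex b) i := hab
  obtain ⟨i, hi, hlt⟩ := h
  show ∃ i, (∀ j, j < i → FermionBox.toSite a j = FermionBox.toSite b j) ∧ FermionBox.toSite a i < FermionBox.toSite b i
  refine ⟨i, fun j hj => ?_, ?_⟩
  · simp only [FermionBox.toSite_apply, hi j hj]
  · simp only [FermionBox.toSite_apply, sub_lt_sub_iff_right, Nat.cast_lt]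
    exact hlt

/-- The box `{-L,…,L}^d` order-embedded in lexicographic `ℤ^d`. [folklore] -/
def boxEmb (d L : ℕ) : FermionBox d L ↪o Lex (Site d) := OrderEmbedding.ofStrictMono _ toSite_strictMono

/-- `boxEmb` is `toSite`. [folklore] -/
@[simp] theorem ofLex_boxEmb (x : FermionBox d L) : ofLex (boxEmb d L x) = FermionBox.toSite x := rfl

/-- `siteEmb (boxEmb d L)` is `toSite`. [folklore] -/
@[simp] theorem siteEmb_boxEmb_apply (x : FermionBox d L) : siteEmb (boxEmb d L) x = FermionBox.toSite x := rfl

/-- `toSite` is injective. [folklore] -/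
theorem toSite_injective : Function.Injective (FermionBox.toSite : FermionBox d L → Site d) :=
  (siteEmb (boxEmb d L)).injective

/-- The box graph is the induced nearest-neighbour graph. [cite: FriedliVelenik2017, §3.2] -/
theorem fermionBoxGraph_adj_iff (x y : FermionBox d L) :
    (fermionBoxGraph d L).Adj x y ↔ (zdGraph d).Adj (ofLex (boxEmb d L x)) (ofLex (boxEmb d L y)) := Iff.rfl

/-- The box graph has maximal degree `≤ 2d`. [cite: FriedliVelenik2017, §3.1] -/
theorem card_filter_fermionBoxGraph_adj_le (v : FermionBox d L) :
    (Finset.univ.filter ((fermionBoxGraph d L).Adj v)).card ≤ 2 * d :=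
  card_filter_adj_le_of_injective FermionBox.toSite toSite_injective (fermionBoxGraph d L)
    (fun a b h => (fermionBoxGraph_adj a b).1 h) v

variable {β U μ : ℂ}

/-- **The box weights are the lattice activities**: the site activity of `A' ⊆ Λ_L` computed
in the box equals `ρ(toSite A')` (`z₀ ≠ 0`). [cite: Ueltschi1999, §2.3 (the expansion of Tr e^{-βH_Λ} produces the weights ρ(𝒜), 𝒜 ⊂ Λ)] -/
theorem siteActivity_fermionBox (hz : atomicPartitionFn β U μ ≠ 0) (τ : ℂ) (A' : Finset (FermionBox d L)) :
    siteActivity (fermionBoxGraph d L) β U μ τ A' = latticeActivity d β U μ τ (A'.map (siteEmb (boxEmb d L))) :=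
  siteActivity_eq_latticeActivity hz (boxEmb d L) fermionBoxGraph_adj_iff τ A'

/-- A preimage of a site of the box. [folklore] -/
def ofSite (L : ℕ) (z : Site d) : FermionBox d L :=
  toLex fun i => ⟨(z i + L).toNat % (2 * L + 1), Nat.mod_lt _ (Nat.succ_pos _)⟩

/-- `toSite ∘ ofSite = id` on the box. [folklore] -/
theorem toSite_ofSite {z : Site d} (hz : z ∈ box d L) : FermionBox.toSite (ofSite L z) = z := by
  funext i
  obtain ⟨h1, h2⟩ := (mem_box.1 hz) i
  simp only [FermionBox.toSite_apply, ofSite, ofLex_toLex]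
  have h3 : (z i + L).toNat < 2 * L + 1 := by omega
  rw [Nat.mod_eq_of_lt h3]
  omega

/-- `toSite` maps onto the box. [folklore] -/
theorem map_univ_toSite : (Finset.univ : Finset (FermionBox d L)).map (siteEmb (boxEmb d L)) = box d L := by
  ext z
  simp only [Finset.mem_map, Finset.mem_univ, true_and, siteEmb_boxEmb_apply]
  constructor
  · rintro ⟨x, rfl⟩; exact FermionBox.toSite_mem_box x
  · intro hz; exact ⟨ofSite L z, toSite_ofSite hz⟩

/-- The box preimage of a finite subset of `ℤ^d`. [folklore] -/
def boxPre (L : ℕ) (A : Finset (Site d)) : Finset (FermionBox d L) :=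
  Finset.univ.filter fun x => FermionBox.toSite x ∈ A

/-- A subset of the box is the image of its preimage. [folklore] -/
theorem map_boxPre {A : Finset (Site d)} (hA : A ⊆ box d L) : (boxPre L A).map (siteEmb (boxEmb d L)) = A := by
  ext z
  simp only [boxPre, Finset.mem_map, Finset.mem_filter, Finset.mem_univ, true_and, siteEmb_boxEmb_apply]
  constructor
  · rintro ⟨x, hx, rfl⟩; exact hx
  · intro hz; exact ⟨ofSite L z, by rw [toSite_ofSite (hA hz)]; exact hz, toSite_ofSite (hA hz)⟩

/-- **The polymer representation of the box partition function in lattice coordinates**: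
`Tr e^{-β(H_{Λ_L} - μN)} = z₀^{|Λ_L|} · Ξ^{polyInc}_{𝒫(box d L)}(ρ)` with the lattice activity
`ρ = latticeActivity d β U μ (βt)` (real parameters). [cite: Ueltschi1999, §2.3 (Tr e^{-βH_Λ} = e^{-βf₀|Λ|} Σ Π ρ(𝒜_j)) and §3] -/
theorem partitionFn_box_eq (β t U μ : ℝ) (L : ℕ) :
    Matrix.partitionFn β (hamiltonianWith (fermionBoxGraph d L) t U μ) =
      atomicPartitionFn β U μ ^ Fintype.card (FermionBox d L) *
        polymerPartitionFunction polyInc (latticeActivity d (β : ℂ) (U : ℂ) (μ : ℂ) ((β : ℂ) * (t : ℂ))) (box d L).powerset := by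
  have hz : atomicPartitionFn (β : ℂ) (U : ℂ) (μ : ℂ) ≠ 0 := by
    rw [atomicPartitionFn_ofReal]; exact_mod_cast (atomicPartitionFnReal_pos β U μ).ne'
  have h0 : Matrix.partitionFn β (hamiltonianWith (fermionBoxGraph d L) t U μ) =
      atomicPartitionFn β U μ ^ Fintype.card (FermionBox d L) *
        polymerPartitionFunction polyInc (siteActivity (fermionBoxGraph d L) (β : ℂ) (U : ℂ) (μ : ℂ) ((β : ℂ) * (t : ℂ)))
          (Finset.univ : Finset (FermionBox d L)).powerset := by
    convert partitionFn_eq_mul_polymerPartitionFunction (G := fermionBoxGraph d L) β t U μ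
  rw [h0]
  congr 1
  -- relabel the polymers `A' ⊆ Λ_L` by their images `toSite A' ⊆ box`
  have himage : (Finset.univ : Finset (FermionBox d L)).powerset.image (Finset.map (siteEmb (boxEmb d L))) =
      (box d L).powerset := by
    ext S
    simp only [Finset.mem_image, Finset.mem_powerset]
    constructor
    · rintro ⟨A', -, rfl⟩ z hz
      obtain ⟨x, -, rfl⟩ := Finset.mem_map.1 hz
      exact FermionBox.toSite_mem_box x
    · intro hS
      exact ⟨boxPre L S, Finset.subset_univ _, map_boxPre hS⟩
  rw [← himage]
  symm
  refine polymerPartitionFunction_image (fun A _ B _ h => Finset.map_injective _ h) (fun A _ B _ => ?_) fun A _ => ?_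
  · -- `polyInc` is preserved by injective images
    unfold polyInc
    rw [(Finset.map_injective (siteEmb (boxEmb d L))).eq_iff, ← Finset.map_inter, Finset.map_nonempty]
  · exact (siteActivity_fermionBox hz _ A).symm

end Box

/-! ### Smallness on `ℤ²` -/

section Smallness

/-- The smallness threshold for `|τ| = |βt|` on `ℤ²`: `τ₀ = (4 e⁶ · 2178)⁻¹` (so that
`λ = 4e⁶|τ|` satisfies `33² λ ≤ 1/2` and `32 λ ≤ 1`). Ueltschi's explicit constant for the cubic
lattice is `1.75 · 10⁻⁴`; ours is not optimised. [cite: Ueltschi1999, §3 (βt < ε, explicit but not optimal constants)] -/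
def tau0 : ℝ := (4 * Real.exp 6 * 2178)⁻¹

/-- `τ₀ > 0`. [folklore] -/
theorem tau0_pos : 0 < tau0 := by unfold tau0; positivity

/-- `τ₀ ≤ 1`. [folklore] -/
theorem tau0_le_one : tau0 ≤ 1 := by
  unfold tau0
  rw [inv_le_one_iff₀]
  right
  have : (1 : ℝ) ≤ Real.exp 6 := Real.one_le_exp (by norm_num)
  nlinarith

variable {β U μ : ℂ}

/-- **Kotecký–Preiss smallness of the Hubbard lattice activity on `ℤ²`** (`δ = 1`): for
`z₀ ≠ 0`, site ratio `r ≤ 2` and `|τ| ≤ τ₀`, the lattice activity is a small translation-invariant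
activity in the sense of `PolymerPressure.IsSmallTIActivity`. [cite: Ueltschi1999, §3 (Theorem 3.1 on D₁ via Prop. 2.2: |ρ(𝒜)| ≤ e^{-c|𝒜|} when 2χe^{c+1}βt ≤ 1)] -/
theorem isSmallTIActivity_latticeActivity (hz : atomicPartitionFn β U μ ≠ 0) (hr : siteRatio β U μ ≤ 2)
    {τ : ℂ} (hτ : ‖τ‖ ≤ tau0) : IsSmallTIActivity (latticeActivity 2 β U μ τ) 1 where
  shift_invariant v A := latticeActivity_shiftSet hz τ v A
  eq_zero_of_not_isRConnected A hA := by
    by_contra h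
    exact hA (isRConnected_of_latticeActivity_ne_zero h)
  delta_pos := one_pos
  sum_le_one x 𝒜 h𝒜 := by
    classical
    have hτ1 : ‖τ‖ ≤ 1 := hτ.trans tau0_le_one
    -- a box containing all the sets of the family
    set L : ℕ := (𝒜.biUnion id ∪ {x}).sup Site.supNorm with hL
    have hbox : ∀ A ∈ 𝒜, A ⊆ box 2 L := by
      intro A hA y hy
      rw [mem_box_iff_supNorm_le]
      exact Finset.le_sup (f := Site.supNorm) (Finset.mem_union_left _ (Finset.mem_biUnion.2 ⟨A, hA, hy⟩))
    have hxbox : x ∈ box 2 L := by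
      rw [mem_box_iff_supNorm_le]
      exact Finset.le_sup (f := Site.supNorm) (Finset.mem_union_right _ (Finset.mem_singleton_self x))
    -- pass to box coordinates
    set x' : FermionBox 2 L := ofSite L x with hx'
    have hxx' : FermionBox.toSite x' = x := toSite_ofSite hxbox
    set 𝒜' : Finset (Finset (FermionBox 2 L)) := 𝒜.image (boxPre L) with h𝒜'
    have hinj : Set.InjOn (boxPre L) (𝒜 : Set (Finset (Site 2))) := by
      intro A hA B hB h
      rw [← map_boxPre (hbox A hA), ← map_boxPre (hbox B hB), h]
    have hmem : ∀ A' ∈ 𝒜', x' ∈ A' := by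
      intro A' hA'
      obtain ⟨A, hA, rfl⟩ := Finset.mem_image.1 hA'
      exact Finset.mem_filter.2 ⟨Finset.mem_univ _, by rw [hxx']; exact h𝒜 A hA⟩
    have hterm : ∀ A ∈ 𝒜, ‖latticeActivity 2 β U μ τ A‖ * Real.exp ((1 + 1) * A.card) =
        ‖siteActivity (fermionBoxGraph 2 L) β U μ τ (boxPre L A)‖ * Real.exp (2 * (boxPre L A).card) := by
      intro A hA
      rw [siteActivity_fermionBox hz, map_boxPre (hbox A hA), ← Finset.card_map (siteEmb (boxEmb 2 L)), map_boxPre (hbox A hA)]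
      norm_num
    rw [Finset.sum_congr rfl hterm, ← Finset.sum_image
      (f := fun A' => ‖siteActivity (fermionBoxGraph 2 L) β U μ τ A'‖ * Real.exp (2 * (A'.card : ℝ))) hinj]
    -- the finite-volume smallness in the box
    have h6 : 0 < Real.exp 6 := Real.exp_pos 6
    have hτ' : ‖τ‖ ≤ (4 * Real.exp 6 * 2178)⁻¹ := hτ
    have hprod : 4 * Real.exp 6 * 2178 * ‖τ‖ ≤ 1 := by
      have h := mul_le_mul_of_nonneg_left hτ' (by positivity : (0 : ℝ) ≤ 4 * Real.exp 6 * 2178)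
      rwa [mul_inv_cancel₀ (by positivity : (4 * Real.exp 6 * 2178 : ℝ) ≠ 0)] at h
    have hX : 0 ≤ Real.exp 6 * ‖τ‖ := by positivity
    have hsmall : ((8 * 4 : ℕ) + 1 : ℝ) ^ 2 * (Real.exp 6 * 2 ^ 2 * ‖τ‖) ≤ 1 / 2 := by
      push_cast
      nlinarith [hprod, hX]
    have h := sum_norm_siteActivity_mul_exp_le (G := fermionBoxGraph 2 L) (Δ := 4)
      (fun v => card_filter_fermionBoxGraph_adj_le v) hz (r₀ := 2) (by norm_num) hr hτ1 hsmall x' 𝒜' hmem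
    refine h.trans ?_
    push_cast
    nlinarith [hprod, hX]

end Smallness

end Literature.MathematicalPhysics.QuantumLattice

end
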